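import Summits.QuantumFields.BalabanUV.Beta.RootedHolonomyReflection

/-!
# `BalabanUV.Beta.RootedHolonomyReflectionHol` — axis reflections transported through node 12's free letter group, part 2:
# holonomy naturality under the letter reflection and the GROUP-LEVEL reflection law of the centred one-step averaging
# `PhiGAt (ctr d L)` (β sub-cell, row BETA-an1, gen 28; module M1b of the letter-law plan, typer LEAVES row HR-W-LET)

HONEST FRAMING (cell charter, verbatim): «discharging BetaPertH makes Balaban's UV stability UNCONDITIONAL — a real
constructive-QFT result; it is NOT the continuum limit and NOT the Clay problem.»  HONEST DEPENDENCY: continuum YM on T⁴ ⇐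
BetaPertH ∧ nine spine estimates (0/9 proved); BetaPertH ⇐ (D1) ∧ (D4) ∧ CAP+tail; G-an2-4 gates asym, D1 and NE2/3/4.
DERIVED cell leaf (pub-balaban β sub-cell, lane an1 gen 28): [folklore] lattice combinatorics and ring algebra over an1's
nodes 5ρ/12/12b and an5's `RootedComb`, all imported BY NAME; no statement of Bałaban's papers is typed here, no `[cite:]`
tag, no `Prop` fact is minted, no binder of the β-function wall (`hW`/`hR`/`D1Tel`/`D1Rep`, (D1), `BetaPertH`) is
instantiated or discharged.  NOT summit progress.

## What this module is for

Sequel of `RootedHolonomyReflection` (M1a: the generic signed pull-back `R1g`, the letter reflection `refL` and the images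
of node 5ρ's centred contour lists).  Here the letter reflection is pushed through node 12's holonomy `holG` over a
non-commutative coefficient ring and through node 12b's rooted averaging `PhiGAt` — all the group-level input the letter
laws (W-LET-M₂)/(W-LET-S₂) need:

* §3 HOLONOMY NATURALITY: `holG G Ḡ (l.map (refL α)) = holG G^σ Ḡ^σ l` for lists of oriented bond letters, where the
  REFLECTED TRANSPORTER PAIR is `G^σ = reflPair α G Ḡ : (κ, x) ↦ (κ = α ? Ḡ : G) κ (bref α κ x)`, `Ḡ^σ = reflPair α Ḡ G`
  (the `α`-bonds are traversed backwards by the reflected contour, so forward and backward transporters swap there);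
  and `holG_rev_mul / holG_mul_rev`: for a two-sided inverse pair the holonomy of `rev l` is the inverse holonomy.
* §4 THE GROUP-LEVEL REFLECTION LAW OF THE CENTRED AVERAGING, transverse axis (`μ ≠ α`, any `𝕜`-algebra):
  `PhiGAt 𝕜 (ctr d L) G Ḡ L μ (sref α y) = PhiGAt 𝕜 (ctr d L) (reflPair α G Ḡ) (reflPair α Ḡ G) L μ y`.
* §5 longitudinal axis (`μ = α`): the holonomies of the image lists — the closing segment becomes the REVERSED closing
  segment of the re-based reflected bond `(α, bref α α y)` (`holG_reflPair_cSeg_self`), each block loop becomes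
  `hol(rev Γ′) · hol(c′)` (`holG_reflPair_loopCAt_self`), i.e. the `hol(c′)⁻¹`-conjugate of the INVERSE of the loop
  holonomy at the reflected bond (`holG_reflPair_loopCAt_self_conj`, for inverse pairs).  The jet-level consequences
  (`Φ_b(G^σ) = Φ_{b̃}(G)⁻¹` in node 12b's nilpotent carrier, the letter laws of `T2At`/`MjetAt`/`mixFFAt`/`vh₂SAt`) are
  the business of the sequel modules M2–M4 of the plan and are NOT claimed here.

## What is NOT here
No jet, no table, no kernel: nothing about `mixFFAt`/`vh₂SAt`/`(hM2)`/`hBfm` is proved in this file (evidence for the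
corrected letter laws is the seat's exact-arithmetic toy — NOT a theorem).  No new contour object is defined.
-/

namespace Summit.QuantumFields.BalabanUV.Beta.RootedHolonomyReflectionHol

open Finset
open scoped BigOperators
open Literature.MathematicalPhysics.QuantumFieldTheory.Balaban1983to89
open Literature.MathematicalPhysics.QuantumFieldTheory.Balaban1983to89.Beta
open AffineAveraging (Form0 Form1 unitVec unitVec_apply box toSite)
open AveragingContours (shift segUp segDown seg rev corner axialAux axial segUp_length)
open AveragingContoursRooted (gammaCAt loopCAt ctrOff ctr ctr_apply ctrOff_mem_box)
open TransportedContourVariables (mapForm mapForm_apply segUp_map rev_map)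
open AveragingHessianKernels (LettersIn)
open AveragingHessianKernelsRooted (gammaCAt_map loopCAt_map)
open AveragingThirdJet (LetterGrp δ realize realize_delta realize_neg_delta holG holG_nil holG_cons holG_append expT logT)
open AveragingMixedJetTables (PhiGAt lettersIn_segUp_top lettersIn_gammaCAt_top lettersIn_loopCAt_top)
open PolarizationSign (axisReflect axisReflect_apply reflSign)
open ResolventReflection (sref sref_apply sref_add sref_sub bref bref_apply bref_of_ne bref_self R1 R1_apply bflip
  bflip_mem mem_box sref_block toSite_bflip sum_box_bflip reflSign_self reflSign_of_ne axisReflect_zsmul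
  axisReflect_unitVec_of_ne axisReflect_unitVec_self)
open RootedComb (corner_sref segUp_succ' rev_cons segDown_eq_rev_segUp sref_root_ctr rev_append rev_rev
  rotate_append_of_length_eq)

open RootedHolonomyReflection (R1g refL refL_δ map_refL_loopCAt_of_ne map_refL_cSeg_of_ne map_refL_cSeg_self
  map_refL_loopCAt_self)
variable {d : ℕ}

/-! ## §3 Holonomy naturality under the letter reflection; holonomy of reversed lists -/

section Holonomy

variable {S : Type*}

/-- [folklore] THE REFLECTED TRANSPORTER PAIR, first member: `G^σ_κ(x) = G_κ(bref x)` across the axis and `Ḡ_α(bref x)`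
along it (the reflected contour traverses the `α`-bonds backwards). The second member is `reflPair α Ḡ G`. -/
def reflPair (α : Fin d) (G Gb : Form1 d S) : Form1 d S := fun κ x => if κ = α then Gb κ (bref α κ x) else G κ (bref α κ x)

/-- [folklore] `reflPair` off the axis. -/
theorem reflPair_of_ne {α κ : Fin d} (h : κ ≠ α) (G Gb : Form1 d S) (x : Fin d → ℤ) :
    reflPair α G Gb κ x = G κ (sref α x) := by
  rw [reflPair, if_neg h, bref_of_ne h]

/-- [folklore] `reflPair` on the axis. -/
theorem reflPair_self (α : Fin d) (G Gb : Form1 d S) (x : Fin d → ℤ) :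
    reflPair α G Gb α x = Gb α (bref α α x) := by
  rw [reflPair, if_pos rfl]

variable [Ring S]

/-- [folklore] Realizing a reflected forward letter. -/
theorem realize_refL_δ (G Gb : Form1 d S) (α κ : Fin d) (x : Fin d → ℤ) :
    realize G Gb (refL α (δ κ x)) = reflPair α G Gb κ x := by
  rw [refL_δ, R1g, reflPair]
  split_ifs with h
  · rw [realize_neg_delta]
  · rw [realize_delta]

/-- [folklore] Realizing a reflected backward letter. -/
theorem realize_refL_neg_δ (G Gb : Form1 d S) (α κ : Fin d) (x : Fin d → ℤ) :
    realize G Gb (refL α (-δ κ x)) = reflPair α Gb G κ x := by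
  rw [map_neg, refL_δ, R1g, reflPair]
  split_ifs with h
  · rw [neg_neg, realize_delta]
  · rw [realize_neg_delta]

/-- [folklore] **HOLONOMY NATURALITY UNDER THE LETTER REFLECTION:** the holonomy of `(G, Ḡ)` along a letter-reflected list
of oriented bond letters is the holonomy of the reflected pair `(G^σ, Ḡ^σ)` along the original list. -/
theorem holG_map_refL (G Gb : Form1 d S) (α : Fin d) {P : (Fin d → ℤ) → Prop} {l : List (LetterGrp d)}
    (hl : LettersIn δ P l) : holG G Gb (l.map (refL α)) = holG (reflPair α G Gb) (reflPair α Gb G) l := by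
  induction l with
  | nil => simp
  | cons a l ih =>
    have hl' : LettersIn δ P l := fun b hb => hl b (by simp [hb])
    obtain ⟨κ, x, -, rfl | rfl⟩ := hl a (by simp)
    · rw [List.map_cons, holG_cons, holG_cons, ih hl', realize_refL_δ, realize_delta]
    · rw [List.map_cons, holG_cons, holG_cons, ih hl', realize_refL_neg_δ, realize_neg_delta]

/-- [folklore] For a two-sided inverse transporter pair, `hol(rev l) · hol(l) = 1` along any list of oriented bond letters. -/
theorem holG_rev_mul {G Gb : Form1 d S} (hGGb : ∀ κ x, G κ x * Gb κ x = 1) (hGbG : ∀ κ x, Gb κ x * G κ x = 1)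
    {P : (Fin d → ℤ) → Prop} {l : List (LetterGrp d)} (hl : LettersIn δ P l) :
    holG G Gb (rev l) * holG G Gb l = 1 := by
  induction l with
  | nil => simp [rev]
  | cons a l ih =>
    have hl' : LettersIn δ P l := fun b hb => hl b (by simp [hb])
    have key : realize G Gb (-a) * realize G Gb a = 1 := by
      obtain ⟨κ, x, -, rfl | rfl⟩ := hl a (by simp)
      · rw [realize_neg_delta, realize_delta]; exact hGbG κ x
      · rw [neg_neg, realize_delta, realize_neg_delta]; exact hGGb κ x
    rw [rev_cons, holG_append, holG_cons, holG_cons, holG_nil, mul_one, mul_assoc, ← mul_assoc (realize G Gb (-a)),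
      key, one_mul, ih hl']

/-- [folklore] For a two-sided inverse transporter pair, `hol(l) · hol(rev l) = 1`. -/
theorem holG_mul_rev {G Gb : Form1 d S} (hGGb : ∀ κ x, G κ x * Gb κ x = 1) (hGbG : ∀ κ x, Gb κ x * G κ x = 1)
    {P : (Fin d → ℤ) → Prop} {l : List (LetterGrp d)} (hl : LettersIn δ P l) :
    holG G Gb l * holG G Gb (rev l) = 1 := by
  have h := holG_rev_mul hGGb hGbG hl.rev
  rwa [rev_rev] at h

end Holonomy

/-! ## §4 The group-level reflection law of the centred averaging, transverse axis -/

section Averaging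

variable (𝕜 : Type*) [Field 𝕜] {S : Type*} [Ring S] [Algebra 𝕜 S] {L : ℕ} (hL : Odd L)
include hL

/-- [folklore] **THE GROUP-LEVEL REFLECTION LAW OF `Φ^{ρ_c}` ACROSS THE AXIS** (`μ ≠ α`, `L` odd, ANY transporter pair
in ANY `𝕜`-algebra): the centred one-step averaging at the reflected coarse bond `(μ, sref α y)` of `(G, Ḡ)` IS the
centred averaging at `(μ, y)` of the reflected pair `(G^σ, Ḡ^σ)` — block loops re-indexed by `bflip α L`, every list
transported letter by letter (§2), holonomies by §3. -/
theorem PhiGAt_sref_of_ne {α μ : Fin d} (h : μ ≠ α) (G Gb : Form1 d S) (y : Fin d → ℤ) :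
    PhiGAt 𝕜 (ctr d L) G Gb L μ (sref α y) = PhiGAt 𝕜 (ctr d L) (reflPair α G Gb) (reflPair α Gb G) L μ y := by
  have hl : ∀ b ∈ box d L, holG G Gb (loopCAt (ctr d L) δ L μ (sref α y) (bflip α L b))
      = holG (reflPair α G Gb) (reflPair α Gb G) (loopCAt (ctr d L) δ L μ y b) := fun b hb => by
    rw [← map_refL_loopCAt_of_ne hL h y hb, holG_map_refL _ _ _ (lettersIn_loopCAt_top _ δ L μ y b)]
  have hc : holG G Gb (segUp δ ((L : ℤ) • sref α y + ctr d L) μ L)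
      = holG (reflPair α G Gb) (reflPair α Gb G) (segUp δ ((L : ℤ) • y + ctr d L) μ L) := by
    rw [← map_refL_cSeg_of_ne hL h y, holG_map_refL _ _ _ (lettersIn_segUp_top δ _ μ L)]
  have hsum : ∑ b ∈ box d L, logT 𝕜 (holG G Gb (loopCAt (ctr d L) δ L μ (sref α y) b))
      = ∑ b ∈ box d L, logT 𝕜 (holG (reflPair α G Gb) (reflPair α Gb G) (loopCAt (ctr d L) δ L μ y b)) := by
    rw [← sum_box_bflip α L (fun b => logT 𝕜 (holG G Gb (loopCAt (ctr d L) δ L μ (sref α y) b)))]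
    exact Finset.sum_congr rfl fun b hb => by rw [hl b hb]
  rw [PhiGAt, PhiGAt, hsum, hc]

/-- [folklore] The same law read at the bond `(μ, y)` itself: `Φ_{(μ,y)}(G, Ḡ) = Φ_{(μ, sref y)}(G^σ, Ḡ^σ)` (`sref` and
`reflPair α` are involutions). -/
theorem PhiGAt_eq_sref_reflPair_of_ne {α μ : Fin d} (h : μ ≠ α) (G Gb : Form1 d S) (y : Fin d → ℤ) :
    PhiGAt 𝕜 (ctr d L) G Gb L μ y = PhiGAt 𝕜 (ctr d L) (reflPair α G Gb) (reflPair α Gb G) L μ (sref α y) := by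
  have hGG : reflPair α (reflPair α G Gb) (reflPair α Gb G) = G := by
    funext κ x; by_cases hκ : κ = α
    · subst hκ; rw [reflPair_self, reflPair_self, ResolventReflection.bref_bref]
    · rw [reflPair_of_ne hκ, reflPair_of_ne hκ, ResolventReflection.sref_sref]
  have hGb : reflPair α (reflPair α Gb G) (reflPair α G Gb) = Gb := by
    funext κ x; by_cases hκ : κ = α
    · subst hκ; rw [reflPair_self, reflPair_self, ResolventReflection.bref_bref]
    · rw [reflPair_of_ne hκ, reflPair_of_ne hκ, ResolventReflection.sref_sref]
  rw [PhiGAt_sref_of_ne 𝕜 hL h, hGG, hGb]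

end Averaging

/-! ## §5 Longitudinal axis: the holonomies of the image lists -/

section Longitudinal

variable {S : Type*} [Ring S] {L : ℕ} (hL : Odd L)
include hL

/-- [folklore] `μ = α`: the holonomy of the reflected pair along the centred closing segment of `(α, y)` is the holonomy
of `(G, Ḡ)` along the REVERSED closing segment of `(α, bref α α y)`. -/
theorem holG_reflPair_cSeg_self (G Gb : Form1 d S) (α : Fin d) (y : Fin d → ℤ) :
    holG (reflPair α G Gb) (reflPair α Gb G) (segUp δ ((L : ℤ) • y + ctr d L) α L)
      = holG G Gb (rev (segUp δ ((L : ℤ) • bref α α y + ctr d L) α L)) := by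
  rw [← map_refL_cSeg_self hL α y, holG_map_refL _ _ _ (lettersIn_segUp_top δ _ α L)]

/-- [folklore] `μ = α`: the holonomy of the reflected pair around the centred block loop of `(α, y)` at offset `b` is
`hol(rev Γ′) · hol(c′)` over the re-based reflected bond `(α, bref α α y)` at offset `bflip α L b`. -/
theorem holG_reflPair_loopCAt_self (G Gb : Form1 d S) (α : Fin d) (y : Fin d → ℤ) {b : Fin d → ℕ} (hb : b ∈ box d L) :
    holG (reflPair α G Gb) (reflPair α Gb G) (loopCAt (ctr d L) δ L α y b)
      = holG G Gb (rev (gammaCAt (ctr d L) δ L α (bref α α y) (bflip α L b)))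
        * holG G Gb (segUp δ ((L : ℤ) • bref α α y + ctr d L) α L) := by
  rw [← holG_append, ← map_refL_loopCAt_self hL α y hb, holG_map_refL _ _ _ (lettersIn_loopCAt_top _ δ L α y b)]

/-- [folklore] `μ = α`, INVERSE PAIRS: conjugating the image loop holonomy by `hol(c′)` gives the holonomy of the REVERSED
loop at the reflected bond — `hol(c′) · hol_{G^σ}(loop_{(α,y),b}) · hol(rev c′) = hol(rev loop_{(α, y′), b̃})`, i.e. the
image loops are the `hol(c′)⁻¹`-conjugates of the inverse loop holonomies at `(α, y′)`, `y′ = bref α α y`. -/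
theorem holG_reflPair_loopCAt_self_conj {G Gb : Form1 d S} (hGGb : ∀ κ x, G κ x * Gb κ x = 1)
    (hGbG : ∀ κ x, Gb κ x * G κ x = 1) (α : Fin d) (y : Fin d → ℤ) {b : Fin d → ℕ} (hb : b ∈ box d L) :
    holG G Gb (segUp δ ((L : ℤ) • bref α α y + ctr d L) α L)
        * holG (reflPair α G Gb) (reflPair α Gb G) (loopCAt (ctr d L) δ L α y b)
        * holG G Gb (rev (segUp δ ((L : ℤ) • bref α α y + ctr d L) α L))
      = holG G Gb (rev (loopCAt (ctr d L) δ L α (bref α α y) (bflip α L b))) := by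
  rw [holG_reflPair_loopCAt_self hL G Gb α y hb, loopCAt, rev_append, rev_rev, holG_append, mul_assoc, mul_assoc,
    holG_mul_rev hGGb hGbG (lettersIn_segUp_top δ _ α L), mul_one]

/-- [folklore] `μ = α`, INVERSE PAIRS: the image loop holonomy times the `hol(c′)⁻¹`-conjugated loop holonomy at the
reflected bond is `1` (the image loops are conjugated INVERSES). -/
theorem holG_reflPair_loopCAt_self_mul {G Gb : Form1 d S} (hGGb : ∀ κ x, G κ x * Gb κ x = 1)
    (hGbG : ∀ κ x, Gb κ x * G κ x = 1) (α : Fin d) (y : Fin d → ℤ) {b : Fin d → ℕ} (hb : b ∈ box d L) :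
    holG (reflPair α G Gb) (reflPair α Gb G) (loopCAt (ctr d L) δ L α y b)
        * (holG G Gb (rev (segUp δ ((L : ℤ) • bref α α y + ctr d L) α L))
          * holG G Gb (loopCAt (ctr d L) δ L α (bref α α y) (bflip α L b))
          * holG G Gb (segUp δ ((L : ℤ) • bref α α y + ctr d L) α L)) = 1 := by
  have hΓ := lettersIn_gammaCAt_top (ctr d L) (δ : Form1 d (LetterGrp d)) L α (bref α α y) (bflip α L b)
  have hc := lettersIn_segUp_top (δ : Form1 d (LetterGrp d)) ((L : ℤ) • bref α α y + ctr d L) α L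
  rw [holG_reflPair_loopCAt_self hL G Gb α y hb, loopCAt, holG_append]
  -- hol(rev Γ′) hol(c′) · (hol(rev c′) · (hol Γ′ · hol(rev c′)) · hol c′) = 1
  calc holG G Gb (rev (gammaCAt (ctr d L) δ L α (bref α α y) (bflip α L b)))
        * holG G Gb (segUp δ ((L : ℤ) • bref α α y + ctr d L) α L)
        * (holG G Gb (rev (segUp δ ((L : ℤ) • bref α α y + ctr d L) α L))
          * (holG G Gb (gammaCAt (ctr d L) δ L α (bref α α y) (bflip α L b))
            * holG G Gb (rev (segUp δ ((L : ℤ) • bref α α y + ctr d L) α L)))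
          * holG G Gb (segUp δ ((L : ℤ) • bref α α y + ctr d L) α L))
      = holG G Gb (rev (gammaCAt (ctr d L) δ L α (bref α α y) (bflip α L b)))
        * (holG G Gb (segUp δ ((L : ℤ) • bref α α y + ctr d L) α L)
            * holG G Gb (rev (segUp δ ((L : ℤ) • bref α α y + ctr d L) α L)))
        * holG G Gb (gammaCAt (ctr d L) δ L α (bref α α y) (bflip α L b))
        * (holG G Gb (rev (segUp δ ((L : ℤ) • bref α α y + ctr d L) α L))
            * holG G Gb (segUp δ ((L : ℤ) • bref α α y + ctr d L) α L)) := by simp only [mul_assoc]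
    _ = 1 := by
      rw [holG_mul_rev hGGb hGbG hc, holG_rev_mul hGGb hGbG hc, mul_one, mul_one, holG_rev_mul hGGb hGbG hΓ]

end Longitudinal

end Summit.QuantumFields.BalabanUV.Beta.RootedHolonomyReflectionHol
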